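import Literature.Analysis.FluidPDE.TaoFiniteEnergyLerayHopf
import Literature.Analysis.FluidPDE.KNSSTypeIIContinuation
import Literature.Analysis.FluidPDE.LerayLocalRegularH1Proofs
import Literature.Analysis.FluidPDE.TaoEnstrophyLocalisationLeaves
import Literature.Analysis.FluidPDE.NSH1BoundedSmoothing
import Literature.Analysis.FluidPDE.TaoQuantitativeClass
import Literature.Analysis.FluidPDE.NSCriticalClosureTao2021
import HarnessLib

/-!
# Bounded finite-energy classical Navier–Stokes solutions on `ℝ³` are in the Sobolev (BKM / Tao)
# class on every `[δ, T]`, `δ > 0`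

Analysis/FluidPDE proof file (theorems only: no definition, no named fact). It assembles, for
the smallest class in which the tree states the Pałasek-tower / `ns-blowup` cruxes — classical
solutions of the unforced system on the closed slab `[0, T] × ℝ³` with **bounded velocity**
`sup_{[0,T]×ℝ³} |u| < ∞` and **bounded energy** `sup_t ∫|u(t)|² < ∞` —, the classical parabolic
regularisation in the `L²` Sobolev scale:

> for every `0 < δ < T`, all `L²` Sobolev norms `sup_{t ∈ [δ,T]} ‖∇ⁿu(t)‖_{L²}` are finite
> (`HasBoundedSobolevNormsOn (Icc δ T) u`), and (unit viscosity) the translate `u(· + δ)` is the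
> velocity of a solution in Tao's (2013) smooth `H¹` class on `[0, T - δ]` (`IsTaoSolutionOn`:
> `u, ∂ₜu, q ∈ L^∞_t H^k_x` for all `k`, `u ∈ C_t L²`, for a suitable pressure `q`).

This is Robinson–Rodrigo–Sadowski 2016, Thm. 8.17 in the Serrin class `L²(0,T; L^∞)` ("is smooth
on `(0, T]` and for every `ε > 0` is a strong solution on `[ε, T]`") followed by the parabolic
smoothing of strong solutions (RRS Thm. 7.5 / Tao 2013, Cor. 11.1), in the whole-space classical
rendering of the tree; every input is a theorem of the tree:

* Tao 2013, Lemma 8.1 — finite-energy classical solutions are Leray–Hopf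
  (`isLerayHopfOn_of_finiteEnergy`, discharged);
* RRS Thm. 8.17, `H¹` clause — a Leray–Hopf solution in a Serrin class is `H¹`-regular on `(0, T]`
  (`leray_continuation_H1_of_leray_local_strong_H1` + `limsup_eH1NormSq_lt_top_of_serrin`, fed by
  the discharged `leray_local_regular_H1_holds`), for the class `L²_t L^∞_x` of a bounded field
  (`memLqLp_two_top_of_bound`);
* the instantaneous Sobolev smoothing of `H¹`-bounded classical solutions
  (`IsClassicalNSSolutionOn.hasBoundedSobolevNormsOn_of_h1Bounded`, `NSH1BoundedSmoothing.lean`);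
* the embedding of the tree's Sobolev class in Tao's class
  (`IsHkClassicalSolutionOn.exists_isTaoSolutionOn`, `TaoQuantitativeClass.lean`, `ν = 1`).

* `IsClassicalNSSolutionOn.isH1RegularOn_Ioc_of_bounded` — `u` is `H¹`-regular on `(0, T]`.
* `IsClassicalNSSolutionOn.hasBoundedSobolevNormsOn_Icc_of_bounded` — the Sobolev class on
  `[δ, T]`, every `0 < δ < T` (general viscosity `ν > 0`).
* `IsClassicalNSSolutionOn.isHkClassicalSolutionOn_translate_of_bounded`,
  `IsClassicalNSSolutionOn.exists_isTaoSolutionOn_translate_of_bounded` — unit viscosity: the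
  translate `u(· + δ)` is in the tree's class `IsHkClassicalSolutionOn` on `[0, T - δ]` and is the
  velocity of a Tao-class solution there.

Consumer: the discharge of the named fact `ns_backward_uniqueness_finiteEnergy`
(`NSBackwardUniquenessFiniteEnergy.lean`; backward uniqueness by the log-convexity method needs
`w = u₁ - u₂ ∈ C([δ,T]; H²) ∩ C¹([δ,T]; L²)`). WHAT THIS IS NOT: not a regularity claim for
Navier–Stokes — a-priori smoothing for GIVEN bounded solutions on a fixed slab.

## Mathlib / tree search

Tree (`lean search 'of_bounded_classical|SobolevNormsOn.*of_bounded|h1Bounded'`):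
`exists_uniform_iteratedFDeriv_bound_of_bounded_classical` (KNSS (4.10): pointwise derivative
bounds, not `L²`), `hasSmoothExtensionPast_of_bounded_holds` (continuation past `T`, exports no
class), `hasBoundedSobolevNormsOn_Ico_of_norm_le` (needs the class on `[0, T″]` as a hypothesis),
`hasBoundedSobolevNormsOn_of_h1Bounded` (needs the `H¹` bound as a hypothesis) — the composition
below was missing (2026-08-27). Mathlib: `eLpNorm`/`MemLp` bookkeeping only.

## References

* J. C. Robinson, J. L. Rodrigo, W. Sadowski, *The Three-Dimensional Navier–Stokes Equations*,
  CUP 2016, Lemma 8.16–Thm. 8.17 (PDF pp. 130–131), Thm. 7.5 (p. 118). [RobinsonRodrigoSadowski2016]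
* T. Tao, *Localisation and compactness properties of the Navier–Stokes global regularity
  problem*, Anal. PDE 6 (2013) = arXiv:1108.1165, Lemma 8.1, Thm. 5.4, Cor. 11.1. [Tao2011]
-/

noncomputable section

open MeasureTheory Set Function Filter Topology
open scoped NNReal ENNReal ContDiff

namespace Literature.Analysis.FluidPDE

variable {T ν : ℝ} {u : ℝ → (EuclideanSpace ℝ (Fin 3)) → (EuclideanSpace ℝ (Fin 3))} {p : ℝ → (EuclideanSpace ℝ (Fin 3)) → ℝ}

/-! ### `H¹`-regularity on `(0, T]` (RRS Thm. 8.17 in the class `L²_t L^∞_x`) -/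

/-- **A bounded finite-energy classical solution is `H¹`-regular on `(0, T]`** (Robinson–Rodrigo–
Sadowski 2016, Thm. 8.17, second clause, in the Serrin class `L²(0,T;L^∞)`): for a classical
solution of the unforced system on `[0, T] × ℝ³` (`ν > 0`) with bounded velocity and bounded
energy, `t ↦ ‖u(t)‖²_{H¹}` is finite and continuous on `(0, T]`. The solution is Leray–Hopf
(Tao 2013, Lemma 8.1, `isLerayHopfOn_of_finiteEnergy`), lies in `L²_t L^∞_x`
(`memLqLp_two_top_of_bound`), and the tree's discharged local `H¹` theory
(`leray_local_regular_H1_holds`) gives the `H¹` clause through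
`leray_continuation_H1_of_leray_local_strong_H1` and `limsup_eH1NormSq_lt_top_of_serrin`.
[cite: RobinsonRodrigoSadowski2016, Thm. 8.17 (PDF p. 131)] -/
theorem IsClassicalNSSolutionOn.isH1RegularOn_Ioc_of_bounded
    (h : IsClassicalNSSolutionOn (Icc 0 T) ν 0 u p) (hν : 0 < ν) (hT : 0 < T)
    (hfe : ∃ A : ℝ≥0∞, A < ⊤ ∧ ∀ t ∈ Icc 0 T, ∫⁻ x, ‖u t x‖ₑ ^ 2 ≤ A)
    {M : ℝ} (hM : ∀ t ∈ Icc 0 T, ∀ x, ‖u t x‖ ≤ M) : IsH1RegularOn (Ioc 0 T) u := by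
  have hLH : IsLerayHopfOn T ν 0 (u 0) u :=
    (Literature.Analysis.FluidPDE.isLerayHopfOn_of_finiteEnergy h hν hT hfe).1
  -- `u` lies in the Serrin class `L²(0, T; L^∞)`
  have hS : MemLqLp 2 ∞ u (Ioo 0 T) :=
    memLqLp_two_top_of_bound (fun t ht => (h.contDiff_velocity ⟨ht.1.le, ht.2.le⟩).continuous)
      fun t ht x => hM t ⟨ht.1.le, ht.2.le⟩ x
  have h₁ : leray_local_strong_H1 := leray_local_strong_H1_of_regular leray_local_regular_H1_holds
  have h₂ : tao2011_H1_local_almost_regular :=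
    tao2011_H1_local_almost_regular_of_leray leray_local_regular_H1_holds
  obtain ⟨c', hc', hL2⟩ := h₂
  have hA := (lintegral_ofReal_rpow_serrin_lt_top (q := 2) (r := ∞) (u := u) (T := T) (by simp)
    serrin_exponents_two_top hS).ne
  exact leray_continuation_H1_of_leray_local_strong_H1 h₁ ν T hν hT (u 0) u hLH
    fun α β hα hαβ hβ hregI =>
      limsup_eH1NormSq_lt_top_of_serrin hL2 hc' hν hLH (by simp) hA hα hαβ hβ hregI

/-! ### The Sobolev class on `[δ, T]` -/

/-- The classical `L²` gradient norm is the weak dissipation: for a `C¹` field,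
`∫⁻ ‖D¹v‖ₑ² ≤ ‖v‖²_{H¹}` (`‖Dv‖_op² ≤ |Dv|²_F`, and the classical derivative is a weak gradient, at
which the infimum `eWeakGradL2Sq` is attained). [folklore] -/
private theorem lintegral_enorm_iteratedFDeriv_one_sq_le_eH1NormSq {v : (EuclideanSpace ℝ (Fin 3)) → (EuclideanSpace ℝ (Fin 3))} (hv : ContDiff ℝ 1 v) :
    ∫⁻ x, ‖iteratedFDeriv ℝ 1 v x‖ₑ ^ 2 ≤ eH1NormSq v := by
  have hG : HasWeakGradient v (fderiv ℝ v) := hasWeakGradient_fderiv_of_contDiff hv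
  calc ∫⁻ x, ‖iteratedFDeriv ℝ 1 v x‖ₑ ^ 2
      ≤ ∫⁻ x, ENNReal.ofReal (frobeniusNormSq (fderiv ℝ v x)) := by
        refine lintegral_mono fun x => ?_
        rw [← ofReal_norm, norm_iteratedFDeriv_one, ← ENNReal.ofReal_pow (norm_nonneg _)]
        exact ENNReal.ofReal_le_ofReal (sq_opNorm_le_frobeniusNormSq _)
    _ = eWeakGradL2Sq v := (eWeakGradL2Sq_eq_of_hasWeakGradient hG).symm
    _ ≤ eH1NormSq v := le_add_self

/-- **Bounded finite-energy classical solutions have all `L²` Sobolev norms bounded on `[δ, T]`,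
`0 < δ < T`** (RRS 2016, Thm. 8.17 with Thm. 7.5; Tao 2013, Cor. 11.1: parabolic smoothing of
strong solutions). From `isH1RegularOn_Ioc_of_bounded` the squared `H¹` norm is bounded on the
compact `[δ/2, T]`; the translate `u(· + δ/2)` is then an `H¹`-bounded classical solution on
`[0, T - δ/2]`, to which the tree's smoothing theorem
`IsClassicalNSSolutionOn.hasBoundedSobolevNormsOn_of_h1Bounded` applies with `ε = δ/2`.
[cite: RobinsonRodrigoSadowski2016, Thm. 8.17 and Thm. 7.5 (PDF pp. 131, 118)] -/
theorem IsClassicalNSSolutionOn.hasBoundedSobolevNormsOn_Icc_of_bounded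
    (h : IsClassicalNSSolutionOn (Icc 0 T) ν 0 u p) (hν : 0 < ν) (hT : 0 < T)
    (hfe : ∃ A : ℝ≥0∞, A < ⊤ ∧ ∀ t ∈ Icc 0 T, ∫⁻ x, ‖u t x‖ₑ ^ 2 ≤ A)
    {M : ℝ} (hM : ∀ t ∈ Icc 0 T, ∀ x, ‖u t x‖ ≤ M) {δ : ℝ} (hδ : 0 < δ) (hδT : δ < T) :
    HasBoundedSobolevNormsOn (Icc δ T) u := by
  -- the `H¹` bound on `[δ/2, T]`
  have hreg : IsH1RegularOn (Icc (δ / 2) T) u :=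
    (h.isH1RegularOn_Ioc_of_bounded hν hT hfe hM).mono fun t ht => ⟨by linarith [ht.1], ht.2⟩
  obtain ⟨A, hAtop, hA⟩ := hreg.exists_forall_le isCompact_Icc subset_rfl
  -- the translate by `a = δ/2`
  set a : ℝ := δ / 2 with ha
  have ha0 : 0 < a := by positivity
  have haT : 0 < T - a := by rw [ha]; linarith
  set u' : ℝ → (EuclideanSpace ℝ (Fin 3)) → (EuclideanSpace ℝ (Fin 3)) := fun t => u (t + a) with hu'
  set p' : ℝ → (EuclideanSpace ℝ (Fin 3)) → ℝ := fun t => p (t + a) with hp'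
  have hmaps : ∀ t ∈ Icc 0 (T - a), t + a ∈ Icc a T := fun t ht =>
    ⟨by linarith [ht.1], by linarith [ht.2]⟩
  have h' : IsClassicalNSSolutionOn (Icc 0 (T - a)) ν 0 u' p' := by
    have htr := h.comp_add_right a
    have h0 : (fun t => (0 : ℝ → (EuclideanSpace ℝ (Fin 3)) → (EuclideanSpace ℝ (Fin 3))) (t + a)) = 0 := rfl
    rw [h0] at htr
    exact htr.mono (fun t ht => ⟨by linarith [ht.1, ha0], by linarith [ht.2]⟩)
      (uniqueDiffOn_Icc haT)
  -- `L²` and `H¹` bounds of the translate on `[0, T - a]`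
  have hAnn : A = ((A.toNNReal : ℝ≥0) : ℝ≥0∞) := (ENNReal.coe_toNNReal hAtop.ne).symm
  have hE : ∃ C : ℝ≥0, ∀ t ∈ Icc 0 (T - a), ∫⁻ x, ‖u' t x‖ₑ ^ 2 ≤ C := by
    refine ⟨A.toNNReal, fun t ht => ?_⟩
    rw [← hAnn]
    exact le_trans le_self_add (hA (t + a) (hmaps t ht))
  have hH : ∃ C : ℝ≥0, ∀ t ∈ Icc 0 (T - a), ∫⁻ x, ‖iteratedFDeriv ℝ 1 (u' t) x‖ₑ ^ 2 ≤ C := by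
    refine ⟨A.toNNReal, fun t ht => ?_⟩
    rw [← hAnn]
    have hv : ContDiff ℝ 1 (u' t) :=
      (h.contDiff_velocity ⟨ha0.le.trans (hmaps t ht).1, (hmaps t ht).2⟩).of_le (by norm_cast)
    exact (lintegral_enorm_iteratedFDeriv_one_sq_le_eH1NormSq hv).trans (hA (t + a) (hmaps t ht))
  -- smoothing on `[a, T - a]` for the translate, i.e. on `[δ, T]` for `u`
  have haT' : a < T - a := by rw [ha]; linarith
  have hB : HasBoundedSobolevNormsOn (Icc a (T - a)) u' :=
    h'.hasBoundedSobolevNormsOn_of_h1Bounded hν haT hE hH ha0 haT'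
  intro n
  obtain ⟨C, hC⟩ := hB n
  refine ⟨C, fun t ht => ?_⟩
  have hs : t - a ∈ Icc a (T - a) := ⟨by rw [ha]; linarith [ht.1], by linarith [ht.2]⟩
  have := hC (t - a) hs
  simpa only [hu', sub_add_cancel] using this

/-! ### Unit viscosity: the translate is in the tree's and in Tao's class -/

/-- **The translate `u(· + δ)` of a bounded finite-energy classical solution (`ν = 1`) lies in the
tree's Sobolev class `IsHkClassicalSolutionOn` on `[0, T - δ]`** (all `sup_t ‖∇ⁿu‖_{L²}` finite):
`hasBoundedSobolevNormsOn_Icc_of_bounded` read in the `eLpNorm` form of that class.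
[cite: RobinsonRodrigoSadowski2016, Thm. 8.17 and Thm. 7.5 (PDF pp. 131, 118)] -/
theorem IsClassicalNSSolutionOn.isHkClassicalSolutionOn_translate_of_bounded
    (h : IsClassicalNSSolutionOn (Icc 0 T) 1 0 u p) (hT : 0 < T)
    (hfe : ∃ A : ℝ≥0∞, A < ⊤ ∧ ∀ t ∈ Icc 0 T, ∫⁻ x, ‖u t x‖ₑ ^ 2 ≤ A)
    {M : ℝ} (hM : ∀ t ∈ Icc 0 T, ∀ x, ‖u t x‖ ≤ M) {δ : ℝ} (hδ : 0 < δ) (hδT : δ < T) :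
    IsHkClassicalSolutionOn (Icc 0 (T - δ)) (fun t => u (t + δ)) (fun t => p (t + δ)) := by
  have hδT' : 0 < T - δ := sub_pos.2 hδT
  have h' : IsClassicalNSSolutionOn (Icc 0 (T - δ)) 1 0 (fun t => u (t + δ)) (fun t => p (t + δ)) := by
    have htr := h.comp_add_right δ
    have h0 : (fun t => (0 : ℝ → (EuclideanSpace ℝ (Fin 3)) → (EuclideanSpace ℝ (Fin 3))) (t + δ)) = 0 := rfl
    rw [h0] at htr
    exact htr.mono (fun t ht => ⟨by linarith [ht.1, hδ], by linarith [ht.2]⟩)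
      (uniqueDiffOn_Icc hδT')
  have hB : HasBoundedSobolevNormsOn (Icc δ T) u :=
    h.hasBoundedSobolevNormsOn_Icc_of_bounded one_pos hT hfe hM hδ hδT
  refine ⟨h', fun n => ?_⟩
  obtain ⟨Cn, hCn⟩ := hB n
  refine ⟨max 1 Cn, fun s hs => ?_⟩
  have ht : s + δ ∈ Icc δ T := ⟨by linarith [hs.1], by linarith [hs.2]⟩
  calc eLpNorm (iteratedFDeriv ℝ n (u (s + δ))) 2 volume
      ≤ max 1 (Cn : ℝ≥0∞) := eLpNorm_two_le_max_of_lintegral_sq_le (hCn _ ht)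
    _ = ((max 1 Cn : ℝ≥0) : ℝ≥0∞) := by rw [ENNReal.coe_max, ENNReal.coe_one]

/-- **The translate `u(· + δ)` of a bounded finite-energy classical solution (`ν = 1`) is the
velocity of a Tao-class solution on `[0, T - δ]`**: there is a pressure `q` with
`IsTaoSolutionOn (T - δ) 1 (u δ) (u(· + δ)) q` — `u(· + δ), ∂ₜu(· + δ), q ∈ L^∞_t H^k_x` for every
`k`, `u(· + δ) ∈ C([0, T - δ]; L²)` (Tao 2013, Thm. 5.4; the tree's embedding
`IsHkClassicalSolutionOn.exists_isTaoSolutionOn`). The pressure `q` has the same spatial gradient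
as `p(· + δ)` (both pairs are classical solutions with the same velocity).
[cite: Tao2011, Thm. 5.4 and Cor. 11.1] [cite: RobinsonRodrigoSadowski2016, Thm. 8.17 (PDF p. 131)] -/
theorem IsClassicalNSSolutionOn.exists_isTaoSolutionOn_translate_of_bounded
    (h : IsClassicalNSSolutionOn (Icc 0 T) 1 0 u p) (hT : 0 < T)
    (hfe : ∃ A : ℝ≥0∞, A < ⊤ ∧ ∀ t ∈ Icc 0 T, ∫⁻ x, ‖u t x‖ₑ ^ 2 ≤ A)
    {M : ℝ} (hM : ∀ t ∈ Icc 0 T, ∀ x, ‖u t x‖ ≤ M) {δ : ℝ} (hδ : 0 < δ) (hδT : δ < T) :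
    ∃ q : ℝ → (EuclideanSpace ℝ (Fin 3)) → ℝ, IsTaoSolutionOn (T - δ) 1 (u δ) (fun t => u (t + δ)) q := by
  have hHk := h.isHkClassicalSolutionOn_translate_of_bounded hT hfe hM hδ hδT
  obtain ⟨q, hq⟩ := hHk.exists_isTaoSolutionOn (sub_pos.2 hδT)
  refine ⟨q, ?_⟩
  simpa only [zero_add] using hq

end Literature.Analysis.FluidPDE

end
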